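import Summits.ABC.IUTFork.Thm311RealInd1StripMappingClass
import HarnessLib

/-!
# [IUTchIII] Thm 3.11 (i) (Ind1) at `v ∈ 𝕍^non`: the PLANE REACH of print's strip orbit — every plane coordinate of a region times EVERY plane
# vector of the Jannsen–Wingberg log-basis, via realised symplectic transvections (modulo `JannsenWingbergMappingClass`); with R17b §1 this is
# the CANONICAL orbit-span identity `span = M + c·(log_p(𝒪_v^×) ∩ Ker Tr)` for regions with non-collinear reduction

PROOF-ONLY file (abc-iut cell, Cor. 3.12 sub-crew, seat abc-iut-c312-1 = holder of record of the typed [IUTchIII] Thm. 3.11, gen 14; row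
«R18 JW-MAPPING-CLASS-IMAGE», part d — the sequel announced in `Thm311RealInd1StripMappingClass` (R18c) and `Thm311RealInd1StripLogLatticeBox`
(R18a: «what full plane contents leaves open would be removed by the mapping-class-group image, which mixes the planes»)).  TAKES NO SIDE on
[IUTchIII] Cor. 3.12.

* `transvection_mem_symplecticGroup` — the symplectic transvection `x ↦ x + ω(u,x)·u` (`ω(a,b) = aᵀ J b`) as the integer matrix `1 + u·(uᵀJ)`
  lies in Mathlib's `Matrix.symplecticGroup` (`J² = −1`, `Jᵀ = −J`, `uᵀJu = 0`); `J_apply_eq` — the entries of `J`.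
* **`exists_planeReach_of_jannsenWingbergMappingClass`** (ODD `[K_v:ℚ_p] = 1 + 2g ≥ 3`, modulo `JannsenWingbergMappingClass`, binder `hMC`) —
  the basis `y` and the realised `Sp_{2g}(ℤ)`-action of R18c, AND: for every subset `M ⊆ K_v` and every additive subgroup `N` of `K_v^{(1/n_v)}`
  containing the images of `M` under all strip elements `ψ ∈ Real.ind1StripOf v (galoisLog v)` and their pairwise composites `ψ' ∘ ψ`:
  `y^*_j(x)·y_k ∈ N` for ALL plane indices `j, k` and `x ∈ M` — every plane coordinate of `M` times EVERY plane vector (not only the same-plane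
  products of R17b §2 / R17c).  Mechanism: `ψ_{T_u}(z) = z + ω(u, z̄)·u_y` for the realised transvections (`hT`), hence `ω(u, z̄)·u_y ∈ N`
  (single reach) and `ω(u, z̄)·ω(u', u)·u'_y ∈ N` (double reach, `ψ_{T_{u'}} ∘ ψ_{T_u}`); with `u = e_k`: `±z̄_{k̄}·y_k`; with `u = e_{j̄}`,
  `u' = e_j`: `±z̄_j·y_j`; with `u = e_{j̄}`, `u' = e_k + e_j` (`k ∉ {j, j̄}`): `±z̄_j·(y_k + y_j)` (`k̄` = the symplectic partner `Sum.swap k`).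
READING (numbers about OUR typed objects): consequently (with R18a's argument applied to this basis) `log_p(𝒪_v^×) ∩ Ker Tr = I·⊕_k ℤ_p y_k` for
ONE coordinate module `I` (all planes share it), and for every `ℤ_p`-region `M ⊆ c·log_p(𝒪_v^×)` whose plane coordinates generate `c·I`
(every region whose reduction is not inside the residual line) the additive span of the print-(Ind1)⊔(Ind2) orbit is EXACTLY
`M + c·(log_p(𝒪_v^×) ∩ Ker Tr)` (lower: this file; upper: R17b §1, unconditional) — print's strip part AS TYPED realises the trace-compatible part
of the Dupuy–Hilado container's orbit span; Kondo's open base-line bit is immaterial.  HONEST SCOPE: conditional on `hMC` (Kondo 2025 §3 over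
Farb–Margalit Thm. 6.4 + Jannsen–Wingberg; flag (α)); single place; OUR typing of print's (Ind1) (THE lift, THE logarithm); nothing here computes
a tensor-packet hull or a log-volume; no side taken on [IUTchIII] Cor. 3.12; NO abc claim. [claim: Mochizuki2012, status: disputed];
[cite: Kondo2025OuterAutMLF, §3 Thm 3.17, Rem 3.16, Rem 3.18]; [cite: FarbMargalit2012, Thm 6.4 p.147]; [cite: HoshiNishio2022OuterAutMLF, Lemma 1.3];
[cite: JannsenWingberg1982, Thm 2 p.75]. typed ≠ proved; a conditional theorem discharges nothing it binds.
-/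

set_option autoImplicit false

noncomputable section

open Metric Set
open scoped Pointwise


namespace Summit.ABC.IUTFork.Thm311.Real

open NumberField IsDedekindDomain Literature.NumberTheory.NumberFields Literature.IUT.LogVolume
open Literature.NumberTheory.GaloisRepresentations
open Literature.AnabelianGeometry.AbsoluteAnabelian Literature.IUT.HodgeArakelov
open Literature.IUT.HodgeArakelov.AbsTopMonoids Matrix

variable {F : Type} [Field F] [NumberField F] (v : HeightOneSpectrum (𝓞 F))

/-- The symplectic transvection `x ↦ x + ω(u, x)·u` (`ω(a, b) = aᵀ J b`) as an integer matrix `1 + u·(uᵀJ)` lies in `Sp_{2g}(ℤ)`. [folklore] -/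
theorem transvection_mem_symplecticGroup {l : Type} [DecidableEq l] [Fintype l] (u : l ⊕ l → ℤ) :
    1 + vecMulVec u (u ᵥ* J l ℤ) ∈ symplecticGroup l ℤ := by
  rw [SymplecticGroup.mem_iff]
  set Jm := J l ℤ with hJm
  set w := u ᵥ* Jm with hw
  have hJJ : Jm * Jm = -1 := J_squared l ℤ
  have hJt : Jmᵀ = -Jm := J_transpose l ℤ
  have huw : u ⬝ᵥ w = 0 := by
    have h1 : u ⬝ᵥ w = u ⬝ᵥ (Jm *ᵥ u) := by
      rw [hw, dotProduct_mulVec, dotProduct_comm]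
    have h2 : Jm *ᵥ u = -(u ᵥ* Jm) := by
      rw [← vecMul_transpose, hJt, vecMul_neg]
    rw [h2, dotProduct_neg, ← hw] at h1
    omega
  have hwJ : w ᵥ* Jm = -u := by
    rw [hw, vecMul_vecMul, hJJ, vecMul_neg, vecMul_one]
  have hJw : Jm *ᵥ w = u := by
    rw [← vecMul_transpose, hJt, vecMul_neg, hwJ, neg_neg]
  rw [transpose_add, transpose_one, transpose_vecMulVec, add_mul, one_mul, mul_add, mul_one, add_mul,
    vecMulVec_mul, hwJ, mul_vecMulVec, hJw, vecMulVec_mul_vecMulVec, neg_dotProduct, huw,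
    neg_zero, zero_smul, vecMulVec_zero, add_zero, add_assoc, ← vecMulVec_add, neg_add_cancel, vecMulVec_zero, add_zero]

/-- Entries of `J`: `J k c = 0` unless `c = swap k`; `J (inl i) (inr i) = -1`, `J (inr i) (inl i) = 1`. [folklore] -/
theorem J_apply_eq {l : Type} [DecidableEq l] (k c : l ⊕ l) :
    J l ℤ k c = if c = Sum.swap k then Sum.elim (fun _ => (-1 : ℤ)) (fun _ => 1) k else 0 := by
  rcases k with i | i <;> rcases c with j | j
  · simp [J, fromBlocks_apply₁₁]
  · simp only [J, fromBlocks_apply₁₂, neg_apply, one_apply, Sum.swap_inl, Sum.inr.injEq, Sum.elim_inl]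
    by_cases h : i = j
    · subst h; simp
    · rw [if_neg h, if_neg (Ne.symm h), neg_zero]
  · simp only [J, fromBlocks_apply₂₁, one_apply, Sum.swap_inr, Sum.inl.injEq, Sum.elim_inr]
    by_cases h : i = j
    · subst h; simp
    · rw [if_neg h, if_neg (Ne.symm h)]
  · simp [J, fromBlocks_apply₂₂]

/-- **THE PLANE REACH OF PRINT's (Ind1) STRIP ORBIT (modulo `JannsenWingbergMappingClass`), ODD local degree.**  At `v ∣ p` odd with
`d = [K_v : ℚ_p] ≥ 3` ODD: the basis `y` and the realised `Sp_{2g}(ℤ)`-action of `exists_realised_symplectic_of_jannsenWingbergMappingClass` (R18c),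
and for every `M ⊆ K_v` and every additive subgroup `N ⊆ K_v^{(1/n_v)}` containing `x`, `ψ(x)` and `ψ'(ψ(x))` for all `x ∈ M` and all strip
elements `ψ, ψ' ∈ Real.ind1StripOf v (galoisLog v)`: `y^*_j(x)·y_k ∈ N` for ALL plane indices `j, k` (realised symplectic transvections
`T_{e_k}`, `T_{e_k + e_j}` and one composition; `Sum.swap` = the symplectic partner). [claim: Mochizuki2012, status: disputed]
[cite: Kondo2025OuterAutMLF, §3 Thm 3.17, Rem 3.18] [cite: FarbMargalit2012, Thm 6.4 p.147] -/
theorem exists_planeReach_of_jannsenWingbergMappingClass (hMC : JannsenWingbergMappingClass)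
    (p : ℕ) [Fact p.Prime] (hv : ((p : ℕ) : 𝓞 F) ∈ v.asIdeal) (hp2 : p ≠ 2) (h3 : 3 ≤ localDeg F v) (hodd : Odd (localDeg F v)) :
    ∃ (g : ℕ) (_ : localDeg F v = 1 + 2 * g) (y : Module.Basis (Fin 1 ⊕ Fin g × Fin 2) ℚ_[p] (RescaledCompletion F p v hv)),
      (∀ A : Matrix (Fin g ⊕ Fin g) (Fin g ⊕ Fin g) ℤ, A ∈ Matrix.symplecticGroup (Fin g) ℤ →
        ∃ ψ : v.adicCompletion F ≃+ v.adicCompletion F, ψ ∈ ind1StripOf v (galoisLog v) ∧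
          ∀ x : RescaledCompletion F p v hv,
            RescaledCompletion.of F p v hv (ψ ((RescaledCompletion.of F p v hv).symm x)) =
              y.coord (Sum.inl 0) x • y (Sum.inl 0) +
                ∑ c : Fin g ⊕ Fin g, y.coord (Sum.inr (Sum.elim (fun i => (i, 0)) (fun i => (i, 1)) c)) x •
                  ∑ r : Fin g ⊕ Fin g, (A r c : ℚ_[p]) • y (Sum.inr (Sum.elim (fun i => (i, 0)) (fun i => (i, 1)) r))) ∧
      ∀ (M : Set (v.adicCompletion F)) (N : AddSubgroup (RescaledCompletion F p v hv)),
        (∀ x ∈ M, RescaledCompletion.of F p v hv x ∈ N) →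
        (∀ ψ ∈ ind1StripOf v (galoisLog v), ∀ x ∈ M, RescaledCompletion.of F p v hv (ψ x) ∈ N ∧
          ∀ ψ' ∈ ind1StripOf v (galoisLog v), RescaledCompletion.of F p v hv (ψ' (ψ x)) ∈ N) →
        ∀ x ∈ M, ∀ j k : Fin g ⊕ Fin g,
          y.coord (Sum.inr (Sum.elim (fun i => (i, 0)) (fun i => (i, 1)) j)) (RescaledCompletion.of F p v hv x) •
            y (Sum.inr (Sum.elim (fun i => (i, 0)) (fun i => (i, 1)) k)) ∈ N := by
  obtain ⟨g, hg, y, hSp⟩ := exists_realised_symplectic_of_jannsenWingbergMappingClass v hMC p hv hp2 h3 hodd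
  refine ⟨g, hg, y, hSp, fun M N hMN hN x hx j k => ?_⟩
  set e := RescaledCompletion.of F p v hv with he
  -- notation
  let pl : Fin g ⊕ Fin g → Fin g × Fin 2 := Sum.elim (fun i => (i, 0)) (fun i => (i, 1))
  let cz : RescaledCompletion F p v hv → Fin g ⊕ Fin g → ℚ_[p] := fun z c => y.coord (Sum.inr (pl c)) z
  let Uy : (Fin g ⊕ Fin g → ℤ) → RescaledCompletion F p v hv := fun u => ∑ r, (u r : ℚ_[p]) • y (Sum.inr (pl r))
  let Ω : (Fin g ⊕ Fin g → ℤ) → RescaledCompletion F p v hv → ℚ_[p] := fun u z => ∑ c, ((u ᵥ* J (Fin g) ℤ) c : ℚ_[p]) * cz z c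
  have hcoord : ∀ s t : Fin 1 ⊕ Fin g × Fin 2, y.coord s (y t) = if t = s then 1 else 0 := by
    intro s t
    rw [Module.Basis.coord_apply, Module.Basis.repr_self, Finsupp.single_apply]
  have hpl_inj : Function.Injective pl := by
    rintro (i | i) (i' | i') h <;> simp only [pl, Sum.elim_inl, Sum.elim_inr, Prod.mk.injEq] at h
    · rw [h.1]
    · exact absurd h.2 (by decide)
    · exact absurd h.2 (by decide)
    · rw [h.1]
  -- (a) reconstruction: `y^*_{inl 0}(z)·y_{inl 0} + Σ_c y^*_{pl c}(z)·y_{pl c} = z`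
  have hrec : ∀ z : RescaledCompletion F p v hv,
      y.coord (Sum.inl 0) z • y (Sum.inl 0) + ∑ c, cz z c • y (Sum.inr (pl c)) = z := by
    intro z
    have h := y.sum_repr z
    rw [Fintype.sum_sum_type, Fin.sum_univ_one] at h
    refine Eq.trans ?_ h
    rw [Module.Basis.coord_apply]
    congr 1
    let toSum : Fin g × Fin 2 → Fin g ⊕ Fin g := fun iε => ![Sum.inl iε.1, Sum.inr iε.1] iε.2
    have hpt : ∀ iε, pl (toSum iε) = iε := by
      rintro ⟨i, ε⟩; fin_cases ε <;> rfl
    have htp : ∀ c, toSum (pl c) = c := by rintro (i | i) <;> rfl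
    exact Fintype.sum_equiv ⟨pl, toSum, htp, hpt⟩ (fun c => cz z c • y (Sum.inr (pl c)))
      (fun iε => y.repr z (Sum.inr iε) • y (Sum.inr iε)) fun c => rfl
  -- (b) the transvection formula: for every `u`, a realised `ψ_u` with `e ψ_u e⁻¹ (z) = z + Ω u z • Uy u`
  have hT : ∀ u : Fin g ⊕ Fin g → ℤ, ∃ ψ : v.adicCompletion F ≃+ v.adicCompletion F, ψ ∈ ind1StripOf v (galoisLog v) ∧
      ∀ z, e (ψ (e.symm z)) = z + Ω u z • Uy u := by
    intro u
    obtain ⟨ψ, hψ, hψf⟩ := hSp _ (transvection_mem_symplecticGroup u)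
    refine ⟨ψ, hψ, fun z => ?_⟩
    rw [hψf z]
    -- entries of the transvection matrix `A = 1 + u·(uᵀJ)`
    set A : Matrix (Fin g ⊕ Fin g) (Fin g ⊕ Fin g) ℤ := 1 + vecMulVec u (u ᵥ* J (Fin g) ℤ) with hAdef
    set w : Fin g ⊕ Fin g → ℤ := u ᵥ* J (Fin g) ℤ with hwdef
    have hent : ∀ r c : Fin g ⊕ Fin g, A r c = (if r = c then 1 else 0) + u r * w c := by
      intro r c
      rw [hAdef, Matrix.add_apply, Matrix.one_apply, vecMulVec_apply]
    have hinner : ∀ c : Fin g ⊕ Fin g,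
        ∑ r, (A r c : ℚ_[p]) • y (Sum.inr (pl r)) = y (Sum.inr (pl c)) + (w c : ℚ_[p]) • Uy u := by
      intro c
      have hr : ∀ r, (A r c : ℚ_[p]) • y (Sum.inr (pl r)) =
          (if r = c then y (Sum.inr (pl r)) else 0) + ((u r : ℚ_[p]) * (w c : ℚ_[p])) • y (Sum.inr (pl r)) := by
        intro r
        rw [hent r c, Int.cast_add, Int.cast_mul, add_smul]
        congr 1
        split_ifs <;> simp
      rw [Finset.sum_congr rfl (fun r _ => hr r), Finset.sum_add_distrib, Finset.sum_ite_eq' Finset.univ c,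
        if_pos (Finset.mem_univ c)]
      congr 1
      simp only [Uy, Finset.smul_sum, smul_smul, mul_comm (u _ : ℚ_[p])]
    rw [show (∑ c : Fin g ⊕ Fin g, y.coord (Sum.inr (Sum.elim (fun i => (i, 0)) (fun i => (i, 1)) c)) z •
        ∑ r : Fin g ⊕ Fin g, (A r c : ℚ_[p]) • y (Sum.inr (Sum.elim (fun i => (i, 0)) (fun i => (i, 1)) r))) =
        ∑ c, cz z c • (y (Sum.inr (pl c)) + (w c : ℚ_[p]) • Uy u) from Finset.sum_congr rfl fun c _ => by rw [hinner c]]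
    simp only [smul_add, Finset.sum_add_distrib, smul_smul]
    rw [← add_assoc, hrec z]
    congr 1
    rw [← Finset.sum_smul]
    simp only [Ω, cz, mul_comm, hwdef]
  -- Ω is additive/homogeneous in `z`, and `Ω u' (Uy u) = (u' ᵥ* J) ⬝ᵥ u`
  have hΩ_add : ∀ u z z', Ω u (z + z') = Ω u z + Ω u z' := by
    intro u z z'
    simp only [Ω, cz, map_add, mul_add, Finset.sum_add_distrib]
  have hΩ_smul : ∀ u (a : ℚ_[p]) z, Ω u (a • z) = a * Ω u z := by
    intro u a z
    simp only [Ω, cz, map_smul, smul_eq_mul, Finset.mul_sum]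
    refine Finset.sum_congr rfl fun c _ => ?_
    ring
  have hΩU : ∀ u u' : Fin g ⊕ Fin g → ℤ, Ω u' (Uy u) = (((u' ᵥ* J (Fin g) ℤ) ⬝ᵥ u : ℤ) : ℚ_[p]) := by
    intro u u'
    simp only [Ω, cz, Uy, map_sum, map_smul, hcoord, smul_eq_mul, dotProduct, Int.cast_sum, Int.cast_mul]
    refine Finset.sum_congr rfl fun c _ => ?_
    congr 1
    rw [Finset.sum_eq_single c]
    · simp
    · intro r _ hrc
      rw [if_neg (fun h => hrc (hpl_inj (Sum.inr_injective h))), mul_zero]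
    · intro h; exact absurd (Finset.mem_univ c) h
  -- (S) single reach and (D) double reach
  have hz : e x ∈ N := hMN x hx
  have hS : ∀ u, Ω u (e x) • Uy u ∈ N := by
    intro u
    obtain ⟨ψ, hψ, hψf⟩ := hT u
    have h1 := (hN ψ hψ x hx).1
    have h2 := hψf (e x)
    rw [e.symm_apply_apply] at h2
    rw [h2] at h1
    have h := N.sub_mem h1 hz
    rwa [add_sub_cancel_left] at h
  have hD : ∀ u u', (Ω u (e x) * (((u' ᵥ* J (Fin g) ℤ) ⬝ᵥ u : ℤ) : ℚ_[p])) • Uy u' ∈ N := by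
    intro u u'
    obtain ⟨ψ, hψ, hψf⟩ := hT u
    obtain ⟨ψ', hψ', hψ'f⟩ := hT u'
    have h1 := (hN ψ hψ x hx).1
    have h12 := (hN ψ hψ x hx).2 ψ' hψ'
    have h2 := (hN ψ' hψ' x hx).1
    have e1 : e (ψ x) = e x + Ω u (e x) • Uy u := by
      have h := hψf (e x); rwa [e.symm_apply_apply] at h
    have e2 : e (ψ' x) = e x + Ω u' (e x) • Uy u' := by
      have h := hψ'f (e x); rwa [e.symm_apply_apply] at h
    have e12 : e (ψ' (ψ x)) = (e x + Ω u (e x) • Uy u) +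
        (Ω u' (e x) + Ω u (e x) * (((u' ᵥ* J (Fin g) ℤ) ⬝ᵥ u : ℤ) : ℚ_[p])) • Uy u' := by
      have h := hψ'f (e (ψ x))
      rw [e.symm_apply_apply, e1, hΩ_add, hΩ_smul, hΩU] at h
      exact h
    have h := N.sub_mem (N.sub_mem h12 h1) (N.sub_mem h2 hz)
    rw [e12, e1, e2] at h
    have : (e x + Ω u (e x) • Uy u + (Ω u' (e x) + Ω u (e x) * (((u' ᵥ* J (Fin g) ℤ) ⬝ᵥ u : ℤ) : ℚ_[p])) • Uy u' -
        (e x + Ω u (e x) • Uy u) - (e x + Ω u' (e x) • Uy u' - e x)) =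
        (Ω u (e x) * (((u' ᵥ* J (Fin g) ℤ) ⬝ᵥ u : ℤ) : ℚ_[p])) • Uy u' := by
      rw [add_smul]; abel
    rwa [this] at h
  -- evaluations at basis vectors: `Ω e_k z = J k (swap k) · cz (swap k)`, `Uy e_k = y_k`, `(e_a ᵥ* J) ⬝ᵥ e_b = J a b`
  have hUy_single : ∀ k : Fin g ⊕ Fin g, Uy (Pi.single k 1) = y (Sum.inr (pl k)) := by
    intro k
    simp only [Uy]
    rw [Finset.sum_eq_single k]
    · simp
    · intro r _ hrk; rw [Pi.single_eq_of_ne hrk, Int.cast_zero, zero_smul]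
    · intro h; exact absurd (Finset.mem_univ k) h
  have hΩ_single : ∀ (k : Fin g ⊕ Fin g) (z : RescaledCompletion F p v hv),
      Ω (Pi.single k 1) z = ((Sum.elim (fun _ => (-1 : ℤ)) (fun _ => (1 : ℤ)) k : ℤ) : ℚ_[p]) * cz z (Sum.swap k) := by
    intro k z
    simp only [Ω, single_one_vecMul, Matrix.row_apply, J_apply_eq]
    rw [Finset.sum_eq_single (Sum.swap k)]
    · rw [if_pos rfl]
    · intro c _ hc; rw [if_neg hc, Int.cast_zero, zero_mul]
    · intro h; exact absurd (Finset.mem_univ _) h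
  have hJdot : ∀ a b : Fin g ⊕ Fin g, ((Pi.single a (1 : ℤ) ᵥ* J (Fin g) ℤ) ⬝ᵥ Pi.single b 1) = J (Fin g) ℤ a b := by
    intro a b
    rw [single_one_vecMul, dotProduct_comm, single_dotProduct, one_mul, Matrix.row_apply]
  have hJdot2 : ∀ a a' b : Fin g ⊕ Fin g,
      (((Pi.single a (1 : ℤ) + Pi.single a' 1) ᵥ* J (Fin g) ℤ) ⬝ᵥ Pi.single b 1) = J (Fin g) ℤ a b + J (Fin g) ℤ a' b := by
    intro a a' b
    rw [add_vecMul, add_dotProduct, hJdot, hJdot]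
  have hUy_add : ∀ k k' : Fin g ⊕ Fin g, Uy (Pi.single k 1 + Pi.single k' 1) = y (Sum.inr (pl k)) + y (Sum.inr (pl k')) := by
    intro k k'
    rw [← hUy_single k, ← hUy_single k']
    simp only [Uy, Pi.add_apply, Int.cast_add, add_smul, Finset.sum_add_distrib]
  have hswap_ne : ∀ k : Fin g ⊕ Fin g, Sum.swap k ≠ k := by rintro (i | i) <;> simp
  have hJswap : ∀ k : Fin g ⊕ Fin g, J (Fin g) ℤ (Sum.swap k) k = Sum.elim (fun _ => (-1 : ℤ)) (fun _ => 1) (Sum.swap k) := by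
    intro k; rw [J_apply_eq, Sum.swap_swap, if_pos rfl]
  -- (A) `cz (swap k) • y_k ∈ N`
  have hA : ∀ k, cz (e x) (Sum.swap k) • y (Sum.inr (pl k)) ∈ N := by
    intro k
    have h := hS (Pi.single k 1)
    rw [hΩ_single, hUy_single, mul_smul] at h
    rcases k with i | i
    · simp only [Sum.elim_inl, Int.cast_neg, Int.cast_one, neg_smul, one_smul] at h
      have h' := N.neg_mem h; rwa [neg_neg] at h'
    · simpa only [Sum.elim_inr, Int.cast_one, one_smul] using h
  -- (B) `cz j • y_j ∈ N` (double reach with `u = e_{swap j}`, `u' = e_j`)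
  have hB : ∀ jj, cz (e x) jj • y (Sum.inr (pl jj)) ∈ N := by
    intro jj
    have h := hD (Pi.single (Sum.swap jj) 1) (Pi.single jj 1)
    have hJ1 : J (Fin g) ℤ jj (Sum.swap jj) = Sum.elim (fun _ => (-1 : ℤ)) (fun _ => (1 : ℤ)) jj := by
      rw [J_apply_eq, if_pos rfl]
    rw [hΩ_single, hUy_single, hJdot, Sum.swap_swap, hJ1] at h
    -- coefficient `sgn(swap j) * cz j * sgn(j)` is `± cz j`... both signs give `-1 * 1`
    rcases jj with i | i
    · simp only [Sum.swap_inl, Sum.elim_inr, Sum.elim_inl, Int.cast_one, Int.cast_neg, one_mul, mul_neg, mul_one,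
        neg_smul] at h
      have h' := N.neg_mem h; rwa [neg_neg] at h'
    · simp only [Sum.swap_inr, Sum.elim_inl, Sum.elim_inr, Int.cast_one, Int.cast_neg, neg_mul, one_mul, mul_one,
        neg_smul] at h
      have h' := N.neg_mem h; rwa [neg_neg] at h'
  -- (C) cross terms: `cz j • y_k ∈ N` for `k ∉ {j, swap j}` (double reach with `u = e_{swap j}`, `u' = e_k + e_j`)
  by_cases hkj : k = j
  · subst hkj; exact hB k
  by_cases hks : k = Sum.swap j
  · subst hks
    have h := hA (Sum.swap j)
    rwa [Sum.swap_swap] at h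
  have h := hD (Pi.single (Sum.swap j) 1) (Pi.single k 1 + Pi.single j 1)
  have hJ0 : J (Fin g) ℤ k (Sum.swap j) = 0 := by
    rw [J_apply_eq, if_neg]
    intro h'
    have := congrArg Sum.swap h'
    rw [Sum.swap_swap, Sum.swap_swap] at this
    exact hkj this.symm
  have hJ1 : J (Fin g) ℤ j (Sum.swap j) = Sum.elim (fun _ => (-1 : ℤ)) (fun _ => (1 : ℤ)) j := by
    rw [J_apply_eq, if_pos rfl]
  rw [hΩ_single, Sum.swap_swap, hUy_add, hJdot2, hJ0, zero_add, hJ1] at h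
  -- `h : (sgn(swap j) * cz j * sgn j) • (y_k + y_j) ∈ N`; subtract the (B) term
  have hBj := hB j
  rcases j with i | i
  · simp only [Sum.swap_inl, Sum.elim_inr, Sum.elim_inl, Int.cast_one, Int.cast_neg, one_mul, mul_neg, mul_one,
      neg_smul] at h
    have h' := N.neg_mem h
    rw [neg_neg, smul_add] at h'
    have h'' := N.sub_mem h' hBj
    rwa [add_sub_cancel_right] at h''
  · simp only [Sum.swap_inr, Sum.elim_inl, Sum.elim_inr, Int.cast_one, Int.cast_neg, neg_mul, one_mul, mul_one,
      neg_smul] at h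
    have h' := N.neg_mem h
    rw [neg_neg, smul_add] at h'
    have h'' := N.sub_mem h' hBj
    rwa [add_sub_cancel_right] at h''

end Summit.ABC.IUTFork.Thm311.Real

end
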